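import Literature.NumberTheory.Automorphic.CDTTheorem722
import Literature.NumberTheory.Automorphic.BCDTModularity
import Literature.NumberTheory.Automorphic.HeckeAlgebraOfTypeSigma
import Literature.NumberTheory.EllipticCurves.ManinConstantQuadraticTwistClassCertificate
import Literature.NumberTheory.EllipticCurves.ModularityVersionApProofs
import Literature.NumberTheory.EllipticCurves.FramedTateGaloisRep
import Literature.NumberTheory.GaloisRepresentations.ResidualGaloisRep
import HarnessLib

/-!
# Stub-ideation k = 2, GENERATION 7 (home family 2 = RESHAPE) for `stub_liftFive` of crux
# `FreyModularity` (stmt-ABC-11340, route ABC/DefiniteXi, line `Lines/Sketch.lean` sha 21576c53)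

Gen 6 (`STUB_IDEAS_stub_liftFive_2g6.lean`, rc 0, 0 sorries) reshaped the ENTRY side
(`ρ.IsModular ∧ 25 ∤ N ⇒` a weight-2 realisation; Plan A `sig_of_facts`).  Gen 7 cuts the EXIT
side — the `R = T` content — along the two seams the tree already has:

**T1 (split into regimes).**  `¬ 25 ∣ N_W` is the disjoint union of
(G) `¬ 5 ∣ N_W` — `W` good at `5`, `ρ_{W,5}|G₅` flat/crystalline, weight-2 level prime to `5`, and
(M) `5 ∣ N_W ∧ ¬ 25 ∣ N_W` — `W` multiplicative at `5`, `ρ_{W,5}|G₅` ordinary non-crystalline,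
weight-2 level `5M`.  `sig_iff_good_and_mult : Sig ↔ LiftFiveGood ∧ LiftFiveMult` and
`liftFiveMult_of_multRed` (PROVED below).  The ONLY consumer of the stub
(`isModular_freyCurve_of_stubs`, case B, via `liftFive_of_stubs`) meets regime (M) only:
k3 gen-4 G1 `five_dvd_conductorNorm_freyCurve_of_caseB` / `…hasMultiplicativeReductionAt_five…`
(case B ∧ good at 5 ⇒ `12 ∣ #W̃₀(𝔽₅) ≤ 10`).  So `LiftFiveGood` (= the flat / `p ∤ level` half
of Diamond 1996 Thm 5.3) is dead weight for THIS crux and the stub may be reshaped to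
`LiftFiveMultRed` (k3's E6c corner ∩ this split) without touching `FreyModularity_of`.

**T2 (reformulate on the tree's own `R = T` skeleton).**  The numerical criterion
"`length(Φ_A) ≤ length(O/η_B)` ⇒ `A ≅ B`" is PROVED in the tree
(`Literature.RingTheory.CompleteIntersection.bijective_of_length_cotangentModule_le`, CriterionOne.lean:320, 0 sorries), and the modular side `N_Σ, T_Σ, π_f, η_Σ` is TYPED
(`modularLiftsOfTypeSigma`, `heckeAlgebraOfTypeSigma`, `.augmentation`) — but in the
Diamond–Flach–Guo form `p ∤ M`, i.e. it hosts regime (G) only.  Regime (M) needs DDT's own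
`N_Σ` (Darmon–Diamond–Taylor 1995, Def 3.25 / Lemma 3.26, p. 94: type `Σ` = "`ρ|G_ℓ` semistable",
`ℓ² ∤ N_f`, `δ = 1`): the carrier `modularLiftsOfTypeSigmaSemistable` below (`¬ p ^ 2 ∣ M`
instead of `¬ p ∣ M`; `N_Σ ⊆ N_Σ^{ss}`, PROVED).  On that carrier the stub's regime (M) is the
kernel-checked composition
`liftFiveMultRed_of : EntryMinimalMemberFive → MLTTateSemistableFive → ExitFive → LiftFiveMultRed`
— entry (gen-6 chain + an integral minimal frame), the `R_Σ = T_Σ^{ss}` OUTPUT in `N_Σ`-currency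
(the one L-sized piece; Wiles 1995 Thm 3.3 / TW + DDT Thm 3.42 at `ℓ = 5`, ordinary case), and the
exit adapter (k1's `outAdapter_holds` shape + conjugation/base change).

No named fact is introduced; every open piece is an explicit `Prop`.  Crux-directory modules are
not importable on the farm, so `Sig` is restated verbatim (§0).
-/

set_option linter.dupNamespace false
set_option linter.unusedVariables false
set_option linter.unusedSectionVars false

noncomputable section

open scoped MatrixGroups Matrix NumberField ModularForm Polynomial Classical NNReal
open NumberField IsDedekindDomain IsDedekindDomain.HeightOneSpectrum Polynomial Filter
open Literature.NumberTheory Literature.NumberTheory.Automorphic Literature.NumberTheory.Automorphic.BCDT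
open Literature.NumberTheory.GaloisRepresentations Literature.NumberTheory.GaloisRepresentations.ModPGaloisRep
open Literature.NumberTheory.EllipticCurves Literature.NumberTheory.EllipticCurves.ModularForms
open CongruenceSubgroup Rat.HeightOneSpectrum WeierstrassCurve Field IsLocalRing

namespace Summit.ABC.ABC.Cruxes.FreyModularity.StubIdeas.LiftFive2g7

universe u v w

/-! ## §0  The registered signature (verbatim) -/

/-- The registered signature of `stub_liftFive` (`Lines/Sketch.lean` l.170, verbatim). -/
def Sig : Prop :=
  ∀ (W : WeierstrassCurve ℚ) [W.IsElliptic] (ρ : ModPGaloisRep ℚ (ZMod 5) 2),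
    W.IsTorsionGaloisRep 5 ρ → ρ.IsAbsIrreducibleOverSqrt 5 → ¬ 25 ∣ W.conductorNorm ℤ →
    ρ.IsModular → W.IsModularGaloisRepTate 5

/-! ## §1  T1 — the regime split `25 ∤ N = (5 ∤ N) ⊔ (5 ∥ N)` -/

/-- Regime (G): `W` good at `5` (`5 ∤ N_W`; flat / crystalline at `5`; weight-2 level prime to
`5` — the Diamond–Flach–Guo / `modularLiftsOfTypeSigma` setting).  NOT met by the consumer. -/
def LiftFiveGood : Prop :=
  ∀ (W : WeierstrassCurve ℚ) [W.IsElliptic] (ρ : ModPGaloisRep ℚ (ZMod 5) 2),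
    W.IsTorsionGaloisRep 5 ρ → ρ.IsAbsIrreducibleOverSqrt 5 → ¬ 5 ∣ W.conductorNorm ℤ →
    ρ.IsModular → W.IsModularGaloisRepTate 5

/-- Regime (M), conductor form: `5 ∥ N_W` (multiplicative at `5`; ordinary, non-crystalline;
weight-2 level `5M`, `5 ∤ M` — DDT's type `Σ` with `δ = 1`).  The consumer's regime. -/
def LiftFiveMult : Prop :=
  ∀ (W : WeierstrassCurve ℚ) [W.IsElliptic] (ρ : ModPGaloisRep ℚ (ZMod 5) 2),
    W.IsTorsionGaloisRep 5 ρ → ρ.IsAbsIrreducibleOverSqrt 5 → 5 ∣ W.conductorNorm ℤ →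
    ¬ 25 ∣ W.conductorNorm ℤ → ρ.IsModular → W.IsModularGaloisRepTate 5

/-- Regime (M), reduction-type form (what k3's G1 hands over in case B). -/
def LiftFiveMultRed : Prop :=
  ∀ (W : WeierstrassCurve ℚ) [W.IsElliptic] (ρ : ModPGaloisRep ℚ (ZMod 5) 2),
    W.IsTorsionGaloisRep 5 ρ → ρ.IsAbsIrreducibleOverSqrt 5 → W.HasMultiplicativeReductionAtPrime 5 →
    ρ.IsModular → W.IsModularGaloisRepTate 5

/-- RS1 (PROVED): the stub is exactly the conjunction of its two regimes. -/
theorem sig_iff_good_and_mult : Sig ↔ LiftFiveGood ∧ LiftFiveMult := by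
  constructor
  · intro h
    refine ⟨fun W _ ρ hρ hirr h5 hmod => h W ρ hρ hirr ?_ hmod,
      fun W _ ρ hρ hirr _ h25 hmod => h W ρ hρ hirr h25 hmod⟩
    exact fun h25 => h5 (dvd_trans (by norm_num : (5 : ℕ) ∣ 25) h25)
  · rintro ⟨hG, hM⟩ W _ ρ hρ hirr h25 hmod
    by_cases h5 : 5 ∣ W.conductorNorm ℤ
    · exact hM W ρ hρ hirr h5 h25 hmod
    · exact hG W ρ hρ hirr h5 hmod

/-- RS2 (PROVED): `5 ∣ N_W ∧ 25 ∤ N_W ⇒ W` multiplicative at `5` (tree: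
`hasGoodReductionAtPrime_or_hasMultiplicativeReductionAtPrime_of_not_sq_dvd_conductorNorm`,
Silverman ATAEC IV.10.2(c), and `dvd_conductorNorm_iff_not_hasGoodReductionAtPrime`), hence the
reduction-type form implies the conductor form. -/
theorem liftFiveMult_of_multRed (h : LiftFiveMultRed) : LiftFiveMult := by
  intro W _ ρ hρ hirr h5 h25 hmod
  have hsq : ¬ 5 ^ 2 ∣ W.conductorNorm ℤ := by simpa using h25
  have hng : ¬ W.HasGoodReductionAtPrime 5 :=
    (W.dvd_conductorNorm_iff_not_hasGoodReductionAtPrime 5).mp h5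
  rcases hasGoodReductionAtPrime_or_hasMultiplicativeReductionAtPrime_of_not_sq_dvd_conductorNorm
      (V := W) hsq with hg | hm
  · exact absurd hg hng
  · exact h W ρ hρ hirr hm hmod

/-- RS3 (PROVED): the reshaped stub set `{LiftFiveGood, LiftFiveMultRed}` closes `Sig`; the
consumer needs only the second (G1), so `LiftFiveGood` may be dropped from the line. -/
theorem sig_of_good_of_multRed (hG : LiftFiveGood) (hM : LiftFiveMultRed) : Sig :=
  sig_iff_good_and_mult.mpr ⟨hG, liftFiveMult_of_multRed hM⟩

/-! ## §2  T2 — DDT's carrier `N_Σ^{ss}` (Def 3.25 / Lemma 3.26: `ℓ² ∤ N_f`) -/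

section Carrier

variable (p : ℕ) (k : ℤ) {O : Type u} [CommRing O] [TopologicalSpace O]
  (Ō : Type v) [CommRing Ō] [IsLocalRing Ō] [TopologicalSpace Ō] [Algebra O Ō]
  (ρ : FramedGaloisRep ℚ O 2) (S : Set ℕ)

/-- D-M. **Diamond's set `Φ_Σ`** (Diamond, in Cornell–Silverman–Stevens ch. XVII §4, p. 571:
"the set of newforms `g` such that `ρ_g` is a deformation of `ρ̄` of type `Σ` and `N_g` is not
divisible by `ℓ²`", type `Σ` = fixed determinant + minimally ramified outside `Σ` + semistable at
`ℓ`, p. 570) = **DDT's `N_Σ`** (Darmon–Diamond–Taylor 1995, Def 3.25 / Lemma 3.26 p. 94: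
`N_f ∣ ℓ^δ N(ρ̄) ∏_{q ∈ Σ} q^{…}`, `δ ≤ 1`, i.e. `ℓ² ∤ N_f`; semistable case):
verbatim `modularLiftsOfTypeSigma` with the Diamond–Flach–Guo level condition
`¬ p ∣ M` relaxed to `¬ p ^ 2 ∣ M` (weight-2 newforms of level `p M'`, `p ∤ M'`, i.e. curves /
forms ORDINARY NON-CRYSTALLINE at `p`, are admitted).  This is the carrier regime (M) of
`stub_liftFive` lives on; everything downstream of `modularLiftsOfTypeSigma` in
`HeckeAlgebraOfTypeSigma` (trace tuples, `T_Σ`, `π_f`, `η_Σ`, reducedness) copies verbatim. -/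
def modularLiftsOfTypeSigmaSemistable : Set (FramedGaloisRep ℚ Ō 2) :=
  {ρ' | (∃ (M : ℕ) (_ : NeZero M) (g : CuspForm (Gamma1 M) k) (j : coeffCharIntegers g →+* Ō),
          IsNewform1 g ∧ ¬ p ^ 2 ∣ M ∧ IsGaloisRepOfNewform1Int g j {r | r ∣ M * p} ρ') ∧
      (∀ (σ : absoluteGaloisGroup ℚ) (i : ℕ),
          (FramedRep.charpoly ρ' σ).coeff i - algebraMap O Ō ((FramedRep.charpoly ρ σ).coeff i) ∈
            maximalIdeal Ō) ∧
      (∀ σ : absoluteGaloisGroup ℚ,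
          ((ρ' σ : GL (Fin 2) Ō) : Matrix (Fin 2) (Fin 2) Ō).det =
            algebraMap O Ō ((ρ σ : GL (Fin 2) O) : Matrix (Fin 2) (Fin 2) O).det) ∧
      ∀ v : HeightOneSpectrum (𝓞 ℚ), ((primesEquiv v : Nat.Primes) : ℕ) ∉ S →
        ((primesEquiv v : Nat.Primes) : ℕ) ≠ p → ρ'.IsMinimallyRamifiedAt v}

variable {p k Ō ρ S} in
/-- (PROVED) `N_Σ ⊆ N_Σ^{ss}`: the DFG carrier is the `p ∤ M` part of DDT's. -/
theorem modularLiftsOfTypeSigma_subset_semistable :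
    modularLiftsOfTypeSigma p k Ō ρ S ⊆ modularLiftsOfTypeSigmaSemistable p k Ō ρ S := by
  rintro ρ' ⟨⟨M, hM, g, j, hnew, hpM, hgal⟩, hcong, hdet, hmin⟩
  refine ⟨⟨M, hM, g, j, hnew, fun h2 => hpM (dvd_trans (dvd_pow_self p two_ne_zero) h2), hgal⟩,
    hcong, hdet, hmin⟩

variable {p k Ō ρ} in
/-- (PROVED) `N_Σ^{ss}` grows with `Σ` (DDT §2.7, p. 76). -/
theorem modularLiftsOfTypeSigmaSemistable_mono {S S' : Set ℕ} (h : S ⊆ S') :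
    modularLiftsOfTypeSigmaSemistable p k Ō ρ S ⊆ modularLiftsOfTypeSigmaSemistable p k Ō ρ S' := by
  rintro ρ' ⟨hmod, hcong, hdet, hmin⟩
  exact ⟨hmod, hcong, hdet, fun v hv hvp => hmin v (fun hS => hv (h hS)) hvp⟩

/-- `T_Σ^{ss}`: the `O`-subalgebra of `O × ∏_{N_Σ^{ss}} Ō` generated by the trace tuples of good
Frobenii (verbatim `heckeAlgebraOfTypeSigma` on the larger carrier; DDT §3.3 p. 94). -/
def heckeAlgebraOfTypeSigmaSemistable :
    Subalgebra O (O × (modularLiftsOfTypeSigmaSemistable p k Ō ρ S → Ō)) :=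
  Algebra.adjoin O
    ((fun σ : absoluteGaloisGroup ℚ =>
        ((FramedRep.trace ρ σ, fun ρ' => FramedRep.trace (ρ' : FramedGaloisRep ℚ Ō 2) σ) :
          O × (modularLiftsOfTypeSigmaSemistable p k Ō ρ S → Ō))) ''
      {σ | IsGoodFrobenius p ρ S σ})

/-- `π_f : T_Σ^{ss} →ₐ[O] O`, the `f`-coordinate (DDT §3.3 p. 96); `η_Σ^{ss} = π_f(Ann ker π_f)` is
then `congruenceIdeal (augmentationSemistable …)` of `Literature.RingTheory.CompleteIntersection`. -/
def augmentationSemistable : heckeAlgebraOfTypeSigmaSemistable p k Ō ρ S →ₐ[O] O :=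
  (AlgHom.fst O O _).comp (heckeAlgebraOfTypeSigmaSemistable p k Ō ρ S).val

end Carrier

/- NC (IN TREE, PROVED; not re-exported here because the farm snapshot has not built
`Literature.RingTheory.CompleteIntersection.NumericalCriterion` yet — `remote:stale:unbuilt`):
`Literature.RingTheory.CompleteIntersection.bijective_of_length_cotangentModule_le`
(CriterionOne.lean:320; de Smit–Rubin–Schoof Criterion I = Wiles / Lenstra numerical criterion
"`length_O(Φ_A) ≤ length_O(O/η_B)` ⇒ `φ : A → B` bijective"), 0 sorries in that directory. -/

/-! ## §3  Regime (M) in `N_Σ^{ss}(ℤ̄₅)`-currency: entry, the `R = T^{ss}` output, exit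

Coefficients are FIXED to the tree's intended `Ō = ℤ̄₅ = padicAlgClIntegers 5` (valuation ring of
Mathlib's `ℚ̄₅ = PadicAlgCl 5`), `O = Ō`, embedded in `ℚ̄₅` by `ValuationSubring.subtype`: with a
quantified coefficient ring the congruence clause (ii) degenerates (`Ō` a field ⇒ "`≡ mod 𝔪`" is
equality) and X-M below would be false. -/

/-- E-M (ENTRY; gen-6 Plan A + level-optimality + an integral frame; 2–3 cycles mod the gen-6
facts): in regime (M) the stub's hypotheses give a framed `ρ₀ : G_ℚ → GL₂(ℤ̄₅)` which is a
SELF-member of `N_∅^{ss}(ρ₀)` of weight `2` — attached to a weight-2 newform `g₀` of level `M₀`,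
`25 ∤ M₀` (gen 6: `diamond1995_refinedSerre` + `Diamond1995Thm51` + dictionary H3a/H3b), and
minimally ramified at every `v ∤ 5` (E2: level-OPTIMAL `M₀ = N(ρ̄)·5^δ` ⇒ minimally ramified off
`5`, DFG §3.1 p. 715–716 "`N_∅ ≠ ∅` by level lowering"; integral frame: Deligne–Serre 6.7 /
compactness) — whose Frobenius polynomials are congruent in `ℚ̄₅` to those of `ρ_{W,5}`
(⟺ `ρ̄₀^{ss} ≅ ρ ⊗ 𝔽̄₅`, Brauer–Nesbitt; `W.IsTorsionGaloisRep 5 ρ`) and whose determinant IS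
`det ρ_{W,5} = χ₅` (trivial nebentypus; Chebotarev + continuity). -/
def EntryMinimalMemberFive : Prop :=
  ∀ (W : WeierstrassCurve ℚ) [W.IsElliptic] (ρ : ModPGaloisRep ℚ (ZMod 5) 2),
    W.IsTorsionGaloisRep 5 ρ → ρ.IsAbsIrreducibleOverSqrt 5 → W.HasMultiplicativeReductionAtPrime 5 →
    ρ.IsModular →
    ∃ ρ₀ : FramedGaloisRep ℚ (padicAlgClIntegers 5) 2,
      ρ₀ ∈ modularLiftsOfTypeSigmaSemistable 5 2 (padicAlgClIntegers 5) ρ₀ ∅ ∧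
      (∀ (σ : absoluteGaloisGroup ℚ) (i : ℕ),
        Valued.v (((FramedRep.charpoly ρ₀ σ).coeff i : PadicAlgCl 5) -
          (FramedRep.charpoly (W.framedTateGaloisRep 5) σ).coeff i) < 1) ∧
      ∀ σ : absoluteGaloisGroup ℚ,
        (((ρ₀ σ : GL (Fin 2) (padicAlgClIntegers 5)) :
            Matrix (Fin 2) (Fin 2) (padicAlgClIntegers 5)).det : PadicAlgCl 5) =
          ((W.framedTateGaloisRep 5 σ : GL (Fin 2) (PadicAlgCl 5)) :
            Matrix (Fin 2) (Fin 2) (PadicAlgCl 5)).det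

/-- X-M (THE `R_Σ = T_Σ^{ss}` OUTPUT for regime (M), in `N_Σ`-currency — the one L-sized piece:
Wiles 1995 Thm 3.3 + Taylor–Wiles in the ordinary non-flat case at `ℓ = 5`, as organised in DDT
§3.4–3.5 (Thm 3.42) around the numerical criterion, which the tree HAS
(`bijective_of_length_cotangentModule_le`); = Diamond 1996 Thm 5.3 ∩ {multiplicative at 5}):
for `W` multiplicative at `5` with `W[5] ≅ ρ` absolutely irreducible over `ℚ(√5)`, every minimal
weight-2 member `ρ₀ ∈ N_∅^{ss}(ρ₀)` congruent to `ρ_{W,5}` with `det ρ₀ = det ρ_{W,5}` (as E-M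
produces) and every finite `Σ ∌ 5` containing the bad primes `≠ 5` of `W` admit a member
`ρ' ∈ N_Σ^{ss}(ρ₀)` with `ρ' ⊗ ℚ̄₅` conjugate to `ρ_{W,5}`.  Informal proof: an integral frame of
`ρ_{W,5}` is a type-`Σ` lift of `ρ̄₀` (ordinary at `5` since multiplicative; `det = ε`; unramified,
hence minimally ramified, off `Σ ∪ {5}`), so it is a point of `R_Σ ≅ T_Σ^{ss} ↪ ∏_{N_Σ^{ss}} ℤ̄₅`,
i.e. `≅ ρ_g`, `g ∈ Φ_Σ`, `25 ∤ N_g` (DDT Lemma 3.26). -/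
def MLTTateSemistableFive : Prop :=
  ∀ (W : WeierstrassCurve ℚ) [W.IsElliptic] (ρ : ModPGaloisRep ℚ (ZMod 5) 2),
    W.IsTorsionGaloisRep 5 ρ → ρ.IsAbsIrreducibleOverSqrt 5 → W.HasMultiplicativeReductionAtPrime 5 →
    ∀ (hf : Continuous (padicAlgClIntegers 5).subtype)
      (ρ₀ : FramedGaloisRep ℚ (padicAlgClIntegers 5) 2) (S : Set ℕ),
      ρ₀ ∈ modularLiftsOfTypeSigmaSemistable 5 2 (padicAlgClIntegers 5) ρ₀ ∅ →
      (∀ (σ : absoluteGaloisGroup ℚ) (i : ℕ),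
        Valued.v (((FramedRep.charpoly ρ₀ σ).coeff i : PadicAlgCl 5) -
          (FramedRep.charpoly (W.framedTateGaloisRep 5) σ).coeff i) < 1) →
      (∀ σ : absoluteGaloisGroup ℚ,
        (((ρ₀ σ : GL (Fin 2) (padicAlgClIntegers 5)) :
            Matrix (Fin 2) (Fin 2) (padicAlgClIntegers 5)).det : PadicAlgCl 5) =
          ((W.framedTateGaloisRep 5 σ : GL (Fin 2) (PadicAlgCl 5)) :
            Matrix (Fin 2) (Fin 2) (PadicAlgCl 5)).det) →
      S.Finite → 5 ∉ S → (∀ q : ℕ, q.Prime → q ∣ W.conductorNorm ℤ → q ≠ 5 → q ∈ S) →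
      ∃ ρ' ∈ modularLiftsOfTypeSigmaSemistable 5 2 (padicAlgClIntegers 5) ρ₀ S,
        ∃ P : GL (Fin 2) (PadicAlgCl 5),
          FramedRep.conj P (FramedRep.baseChange (padicAlgClIntegers 5).subtype hf ρ') =
            W.framedTateGaloisRep 5

/-- EXIT (k1's `outAdapter_holds` shape, transported along `ℤ̄₅ ⊆ ℚ̄₅` and a conjugation;
1 cycle: `FramedRep.charpoly_baseChange`, conjugation-invariance of `charpoly`,
`isUnramifiedAt_conj_iff`, `FramedGaloisRep.isUnramifiedAt_baseChange_iff`, the extension of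
`j : 𝓞_g → ℤ̄₅ ⊆ ℚ̄₅` to a field map `K_g →+* ℚ̄₅` (`𝓞_g` is integral over `ℤ` and `ker j` lies
over `(0)`, hence is `0`), and `map_charpoly_galoisRepTate_eq` (framed ↔ unframed Tate module). -/
def ExitFive : Prop :=
  ∀ (W : WeierstrassCurve ℚ) [W.IsElliptic] (hf : Continuous (padicAlgClIntegers 5).subtype)
    {M : ℕ} [NeZero M] (g : CuspForm (Gamma1 M) 2)
    (j : coeffCharIntegers g →+* padicAlgClIntegers 5)
    (ρ' : FramedGaloisRep ℚ (padicAlgClIntegers 5) 2) (P : GL (Fin 2) (PadicAlgCl 5)),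
    IsNewform1 g → IsGaloisRepOfNewform1Int g j {r | r ∣ M * 5} ρ' →
    FramedRep.conj P (FramedRep.baseChange (padicAlgClIntegers 5).subtype hf ρ') =
      W.framedTateGaloisRep 5 →
    W.IsModularGaloisRepTate 5

/-- ASSEMBLY OF REGIME (M) (PROVED, pure logic): entry + `R = T^{ss}` output + exit give the
reshaped stub `LiftFiveMultRed`; with `liftFiveMult_of_multRed` / `sig_of_good_of_multRed` this is
the stub minus its dead regime (G).  `Σ :=` the primes `q ≠ 5` dividing `N_W` (finite because
`N_W > 0`, `conductorNorm_pos_holds`). -/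
theorem liftFiveMultRed_of (hE : EntryMinimalMemberFive) (hX : MLTTateSemistableFive)
    (hO : ExitFive) : LiftFiveMultRed := by
  intro W _ ρ hρ hirr hm hmod
  obtain ⟨ρ₀, hself, hcong, hdet⟩ := hE W ρ hρ hirr hm hmod
  classical
  have hf : Continuous (padicAlgClIntegers 5).subtype := continuous_subtype_val
  have hN : W.conductorNorm ℤ ≠ 0 := (W.conductorNorm_pos_holds).ne'
  let S : Set ℕ := {q | q.Prime ∧ q ∣ W.conductorNorm ℤ ∧ q ≠ 5}
  have hSfin : S.Finite :=
    (Set.finite_Iic (W.conductorNorm ℤ)).subset fun q hq =>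
      Set.mem_Iic.mpr (Nat.le_of_dvd (Nat.pos_of_ne_zero hN) hq.2.1)
  have h5S : (5 : ℕ) ∉ S := fun h => h.2.2 rfl
  have hSall : ∀ q : ℕ, q.Prime → q ∣ W.conductorNorm ℤ → q ≠ 5 → q ∈ S :=
    fun q hq hqd hq5 => ⟨hq, hqd, hq5⟩
  obtain ⟨ρ', hmem, P, hconj⟩ :=
    hX W ρ hρ hirr hm hf ρ₀ S hself hcong hdet hSfin h5S hSall
  obtain ⟨⟨M, hM, g, j, hnew, _, hgal⟩, _, _, _⟩ := hmem
  exact hO W hf g j ρ' P hnew hgal hconj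

/-- The whole reshaped stub, kernel-checked: regime (G) (dead for the consumer, = the flat half of
Diamond 1996 Thm 5.3 / the tree's DFG-typed `modularLiftsOfTypeSigma` programme) + the three
regime-(M) pieces give `Sig`. -/
theorem sig_of_pieces (hG : LiftFiveGood) (hE : EntryMinimalMemberFive)
    (hX : MLTTateSemistableFive) (hO : ExitFive) : Sig :=
  sig_of_good_of_multRed hG (liftFiveMultRed_of hE hX hO)

end Summit.ABC.ABC.Cruxes.FreyModularity.StubIdeas.LiftFive2g7
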